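import Summits.CriticalPhenomena.PercolationContinuityZ3.Theorems.PercNearOneGluingNoHeavyQuantFarGate3Cells
import Summits.CriticalPhenomena.PercolationContinuityZ3.Theorems.PercNearOneGluingNoHeavyQuantFarGate3Coupled
import HarnessLib

/-!
# QUANT lane R8, front "FAR beyond trees", layer one — **THE DEGREE-THREE GATE AT THE OBSERVER, VI: FAR(1) FOR TAME GATES (Harris regime)**

builds on p205010 (kernel theorem, internal audit signed; external expert review pending)

Support file (`--supports stmt-CriticalPhenomena-4575`), seat `prim-quant-p1` (gen 28); memo
`run/shared/lean/prim/quant/prim-quant-p1-g28/FOR-LEAD-GATE3.md` §6(d).  Standard axioms; no sorries; no definitions.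

**THEOREM (`Quant.farLayerOne_of_gate3_tame`).**  Degree-three gate at the observer as in file IV (`v ∈ A` adjacent to `o` with weight `p`, to the
relays `u₁, u₂ ∈ A` with weights `r₁, r₂`, no other pair at `v`; everything else arbitrary).  Write `sᵢ = p + (1−p)rᵢ`, `Δ = (1−p)² − s₁s₂`,
`κ₁ = s₁r₂ + (1−p)r₁`, `κ₂ = s₂r₁ + (1−p)r₂`.  If the gate is TAME — coupled (`Δ ≤ 0`) or `Δ² ≤ p(1−p)κ₁κ₂ ∧ Δ ≤ (1−p)κ₂` — then
`P(#{a ∈ A : o ↔ a} ≤ 1) ≤ max(P(o ↮ v), P(o ↮ u₁), P(o ↮ u₂))`: the layer-one instance of the far-relay row holds at `(w, A, o)`, again without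
its mean hypothesis.  In the symmetric case `r₁ = r₂ = r` tameness is exactly `r ≥ (1−2p)/(1−p+√(p(1−p)))` (e.g. `r ≥ 2/3` at `p = 1/10`,
`r ≥ 1/2` at `p = 1/5`), the numerically observed boundary of the Harris-free-of-the-mean regime (memo §6(d)).

Proof.  By file III/V the three cuts and `P(N ≤ 1)` are affine in the five type masses `a,b₁,b₂,c,d` of the off-`v` configuration, and Harris'
inequality for the decreasing off-`v` events gives `d·a ≥ b₁(b₂+c)` and `d·a ≥ c(b₁+b₂)` (`Gate3.real_harris₁/₃`).  The pure-real certificate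
`Gate3.arith_tame` is the polynomial identity
`P·a·(U−L_v) + (1−r₂)w₁(U−L₁) + (1−r₁)w₂(U−L₂) = −(1−r₁)(1−r₂)·[Δ²·(da−b₁b₂−b₁c) + σ_ad·ad + σ·(b₁c or b₂c) (+ Δ(pκ₁−Δ)·(da−cb₁−cb₂))]`
(`P = pκ₁κ₂`, `w₁ = pκ₂s₁a + Δ(1−p)b₂ + pκ₁(1−p)c`, `w₂ = pκ₂(1−p)a + Δs₂b₂ + pκ₁s₂c`, two cases `pκ₁ ≶ Δ`), found by solving the LP dual of the
type-level problem by hand (it is feasible exactly on the tame region).  [cite: KozmaNitzan2024, Conjecture 3 (p. 15)] (the row served);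
[cite: Grimmett1999, §1.3 p. 10, Thm. (2.4) p. 34]; [this work].
-/

noncomputable section

namespace Summit.CriticalPhenomena.PercolationContinuityZ3.Theorems

namespace Quant

open Finset MeasureTheory Set
open Literature.Probability.LatticeModels
open Literature.Probability.Percolation
open Bundle (offZ)
open scoped Classical

variable {n : ℕ}

namespace Gate3

/-- Certificate identity, case `pκ₁ ≤ Δ` (a polynomial identity). [this work] -/
theorem tame_identity_A (p r₁ r₂ a b₁ b₂ c d : ℝ) :
    (p * ((p + (1 - p) * r₁) * r₂ + (1 - p) * r₁) * ((p + (1 - p) * r₂) * r₁ + (1 - p) * r₂)) * a * ((p * ((1 - r₁) * (1 - r₂)) * (a + c) + (1 - p) * (r₁ * r₂) * (a + c) + (1 - p) * (r₁ * (1 - r₂)) * (a + c + b₂) + (1 - p) * ((1 - r₁) * r₂) * (a + c + b₁) + (1 - p) * ((1 - r₁) * (1 - r₂)) * (a + c + b₂ + b₁)) - ((1 - p) * (r₁ * r₂) * (a + c) + (1 - p) * (r₁ * (1 - r₂)) * (a + c + b₂) + (1 - p) * ((1 - r₁) * r₂) * (a + c + b₁) + (1 - p) * ((1 - r₁) * (1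 - r₂)) * (a + b₁ + b₂ + c + d))) + (1 - r₂) * (p * ((p + (1 - p) * r₂) * r₁ + (1 - p) * r₂) * (p + (1 - p) * r₁) * a + ((1 - p) ^ 2 - (p + (1 - p) * r₁) * (p + (1 - p) * r₂)) * (1 - p) * b₂ + p * ((p + (1 - p) * r₁) * r₂ + (1 - p) * r₁) * (1 - p) * c) * ((p * ((1 - r₁) * (1 - r₂)) * (a + c) + (1 - p) * (r₁ * r₂) * (a + c) + (1 - p) * (r₁ * (1 - r₂)) * (a + c + b₂) + (1 - p) * ((1 - r₁) * r₂) * (a + c + b₁) + (1 - p) * ((1 - r₁) * (1 - r₂)) * (a + c + b₂ + b₁)) - (p * ((1 - r₁) * r₂) * (a + b₂) + (1 - p) * (r₁ * r₂) * (a + c) + (p * ((1 - r₁) * (1 - r₂)) + (1 - p) * (r₁ * (1 - r₂)) + (1 - p) * ((1 - r₁) * r₂) + (1 - p) * ((1 - r₁) * (1 - r₂))) * (a + c + b₂))) + (1 - r₁) * (p * ((p + (1 - p) * r₂) * r₁ + (1 - p) * r₂) * (1 - p) * a + ((1 - p) ^ 2 - (p + (1 - p) * r₁) * (p + (1 - p)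 * r₂)) * (p + (1 - p) * r₂) * b₂ + p * ((p + (1 - p) * r₁) * r₂ + (1 - p) * r₁) * (p + (1 - p) * r₂) * c) * ((p * ((1 - r₁) * (1 - r₂)) * (a + c) + (1 - p) * (r₁ * r₂) * (a + c) + (1 - p) * (r₁ * (1 - r₂)) * (a + c + b₂) + (1 - p) * ((1 - r₁) * r₂) * (a + c + b₁) + (1 - p) * ((1 - r₁) * (1 - r₂)) * (a + c + b₂ + b₁)) - (p * ((1 - r₂) * r₁) * (a + b₁) + (1 - p) * (r₂ * r₁) * (a + c) + (p * ((1 - r₂) * (1 - r₁)) + (1 - p) * (r₂ * (1 - r₁)) + (1 - p) * ((1 - r₂) * r₁) + (1 - p) * ((1 - r₂) * (1 - r₁))) * (a + c + b₁))) =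
      -((1 - r₁) * (1 - r₂)) * (((1 - p) ^ 2 - (p + (1 - p) * r₁) * (p + (1 - p) * r₂)) ^ 2 * (a * d - b₁ * b₂ - b₁ * c) + ((p * ((p + (1 - p) * r₁) * r₂ + (1 - p) * r₁) * ((p + (1 - p) * r₂) * r₁ + (1 - p) * r₂)) * (1 - p) - ((1 - p) ^ 2 - (p + (1 - p) * r₁) * (p + (1 - p) * r₂)) ^ 2) * (a * d) + ((1 - p) ^ 2 - (p + (1 - p) * r₁) * (p + (1 - p) * r₂)) * (((1 - p) ^ 2 - (p + (1 - p) * r₁) * (p + (1 - p) * r₂)) - p * ((p + (1 - p) * r₁) * r₂ + (1 - p) * r₁)) * (b₁ * c)) := by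
  ring

/-- Certificate identity, case `pκ₁ ≥ Δ` (a polynomial identity). [this work] -/
theorem tame_identity_B (p r₁ r₂ a b₁ b₂ c d : ℝ) :
    (p * ((p + (1 - p) * r₁) * r₂ + (1 - p) * r₁) * ((p + (1 - p) * r₂) * r₁ + (1 - p) * r₂)) * a * ((p * ((1 - r₁) * (1 - r₂)) * (a + c) + (1 - p) * (r₁ * r₂) * (a + c) + (1 - p) * (r₁ * (1 - r₂)) * (a + c + b₂) + (1 - p) * ((1 - r₁) * r₂) * (a + c + b₁) + (1 - p) * ((1 - r₁) * (1 - r₂)) * (a + c + b₂ + b₁)) - ((1 - p) * (r₁ * r₂) * (a + c) + (1 - p) * (r₁ * (1 - r₂)) * (a + c + b₂) + (1 - p) * ((1 - r₁) * r₂) * (a + c + b₁) + (1 - p) * ((1 - r₁) * (1 - r₂)) * (a + b₁ + b₂ + c + d))) + (1 - r₂) * (p * ((p + (1 - p) * r₂) * r₁ + (1 - p) * r₂) * (p + (1 - p) * r₁) * a + ((1 - p) ^ 2 - (p + (1 - p) * r₁) * (p + (1 - p) * r₂)) * (1 - p) * b₂ + p * ((p + (1 - p) * r₁) * r₂ + (1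 - p) * r₁) * (1 - p) * c) * ((p * ((1 - r₁) * (1 - r₂)) * (a + c) + (1 - p) * (r₁ * r₂) * (a + c) + (1 - p) * (r₁ * (1 - r₂)) * (a + c + b₂) + (1 - p) * ((1 - r₁) * r₂) * (a + c + b₁) + (1 - p) * ((1 - r₁) * (1 - r₂)) * (a + c + b₂ + b₁)) - (p * ((1 - r₁) * r₂) * (a + b₂) + (1 - p) * (r₁ * r₂) * (a + c) + (p * ((1 - r₁) * (1 - r₂)) + (1 - p) * (r₁ * (1 - r₂)) + (1 - p) * ((1 - r₁) * r₂) + (1 - p) * ((1 - r₁) * (1 - r₂))) * (a + c + b₂))) + (1 - r₁) * (p * ((p + (1 - p) * r₂) * r₁ + (1 - p) * r₂) * (1 - p) * a + ((1 - p) ^ 2 - (p + (1 - p) * r₁) * (p + (1 - p) * r₂)) * (p + (1 - p) * r₂) * b₂ + p * ((p + (1 - p) * r₁) * r₂ + (1 - p) * r₁) * (p + (1 - p) * r₂) * c) * ((p * ((1 - r₁) * (1 - r₂)) * (a + c) + (1 - p) * (r₁ * r₂) * (a + c) + (1 - p) * (r₁ * (1 - r₂)) * (a + c + b₂) + (1 -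 p) * ((1 - r₁) * r₂) * (a + c + b₁) + (1 - p) * ((1 - r₁) * (1 - r₂)) * (a + c + b₂ + b₁)) - (p * ((1 - r₂) * r₁) * (a + b₁) + (1 - p) * (r₂ * r₁) * (a + c) + (p * ((1 - r₂) * (1 - r₁)) + (1 - p) * (r₂ * (1 - r₁)) + (1 - p) * ((1 - r₂) * r₁) + (1 - p) * ((1 - r₂) * (1 - r₁))) * (a + c + b₁))) =
      -((1 - r₁) * (1 - r₂)) * (((1 - p) ^ 2 - (p + (1 - p) * r₁) * (p + (1 - p) * r₂)) ^ 2 * (a * d - b₁ * b₂ - b₁ * c) + ((1 - p) ^ 2 - (p + (1 - p) * r₁) * (p + (1 - p) * r₂)) * (p * ((p + (1 - p) * r₁) * r₂ + (1 - p) * r₁) - ((1 - p) ^ 2 - (p + (1 - p) * r₁) * (p + (1 - p) * r₂))) * (a * d - c * b₁ - c * b₂) + ((p * ((p + (1 - p) * r₁) * r₂ + (1 - p) * r₁) * ((p + (1 - p) * r₂) * r₁ + (1 - p) * r₂)) * (1 - p) - ((1 - p) ^ 2 - (p + (1 - p) * r₁) * (p + (1 - p) * r₂)) * (p * ((p + (1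 - p) * r₁) * r₂ + (1 - p) * r₁))) * (a * d) + ((1 - p) ^ 2 - (p + (1 - p) * r₁) * (p + (1 - p) * r₂)) * (p * ((p + (1 - p) * r₁) * r₂ + (1 - p) * r₁) - ((1 - p) ^ 2 - (p + (1 - p) * r₁) * (p + (1 - p) * r₂))) * (b₂ * c)) := by
  ring

/-- `U − L_v = (1−r₁)(1−r₂)·(p(a+c) − (1−p)d)`. [this work] -/
theorem tame_excess_v (p r₁ r₂ a b₁ b₂ c d : ℝ) :
    (p * ((1 - r₁) * (1 - r₂)) * (a + c) + (1 - p) * (r₁ * r₂) * (a + c) + (1 - p) * (r₁ * (1 - r₂)) * (a + c + b₂) + (1 - p) * ((1 - r₁) * r₂) * (a + c + b₁) + (1 - p) * ((1 - r₁) * (1 - r₂)) * (a + c + b₂ + b₁)) - ((1 - p) * (r₁ * r₂) * (a + c) + (1 - p) * (r₁ * (1 - r₂)) * (a + c + b₂) + (1 - p) * ((1 - r₁) * r₂) * (a + c + b₁) + (1 - p) * ((1 - r₁) * (1 - r₂)) * (a + b₁ + b₂ + c + d)) = (1 - r₁) * (1 - r₂) * (p * (a + c) - (1 - p) * d) :=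 by
  ring

/-- `U − L₂ = (1−r₂)·((1−p)b₂ − s₁b₁ − p r₁ a)`. [this work] -/
theorem tame_excess_2 (p r₁ r₂ a b₁ b₂ c : ℝ) :
    (p * ((1 - r₁) * (1 - r₂)) * (a + c) + (1 - p) * (r₁ * r₂) * (a + c) + (1 - p) * (r₁ * (1 - r₂)) * (a + c + b₂) + (1 - p) * ((1 - r₁) * r₂) * (a + c + b₁) + (1 - p) * ((1 - r₁) * (1 - r₂)) * (a + c + b₂ + b₁)) - (p * ((1 - r₂) * r₁) * (a + b₁) + (1 - p) * (r₂ * r₁) * (a + c) + (p * ((1 - r₂) * (1 - r₁)) + (1 - p) * (r₂ * (1 - r₁)) + (1 - p) * ((1 - r₂) * r₁) + (1 - p) * ((1 - r₂) * (1 - r₁))) * (a + c + b₁)) = (1 - r₂) * ((1 - p) * b₂ - (p + (1 - p) * r₁) * b₁ - p * r₁ * a) := by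
  ring

/-- **The tame-gate certificate** (pure real arithmetic in the five type masses).  [this work] -/
theorem arith_tame (p r₁ r₂ a b₁ b₂ c d t : ℝ) (hp0 : 0 ≤ p) (hp1 : p ≤ 1) (hr10 : 0 ≤ r₁) (hr11 : r₁ ≤ 1)
    (hr20 : 0 ≤ r₂) (hr21 : r₂ ≤ 1) (ha : 0 ≤ a) (hb1 : 0 ≤ b₁) (hb2 : 0 ≤ b₂) (hc : 0 ≤ c) (hd : 0 ≤ d)
    (hsum : a + b₁ + b₂ + c + d = 1)
    (hreg : ((1 - p) ^ 2 - (p + (1 - p) * r₁) * (p + (1 - p) * r₂)) ≤ 0 ∨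
      (((1 - p) ^ 2 - (p + (1 - p) * r₁) * (p + (1 - p) * r₂)) ^ 2 ≤ p * (1 - p) * ((p + (1 - p) * r₁) * r₂ + (1 - p) * r₁) * ((p + (1 - p) * r₂) * r₁ + (1 - p) * r₂) ∧ ((1 - p) ^ 2 - (p + (1 - p) * r₁) * (p + (1 - p) * r₂)) ≤ (1 - p) * ((p + (1 - p) * r₂) * r₁ + (1 - p) * r₂)))
    (hH1 : (a + c + b₂) * (a + b₁) ≤ a) (hH3 : (a + b₁ + b₂) * (a + c) ≤ a)
    (hLv : ((1 - p) * (r₁ * r₂) * (a + c) + (1 - p) * (r₁ * (1 - r₂)) * (a + c + b₂) + (1 - p) * ((1 - r₁) * r₂) * (a + c + b₁) + (1 - p) * ((1 - r₁) * (1 - r₂))) ≤ t)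
    (hL1 : (p * ((1 - r₁) * r₂) * (a + b₂) + (1 - p) * (r₁ * r₂) * (a + c) + (p * ((1 - r₁) * (1 - r₂)) + (1 - p) * (r₁ * (1 - r₂)) + (1 - p) * ((1 - r₁) * r₂) + (1 - p) * ((1 - r₁) * (1 - r₂))) * (a + c + b₂)) ≤ t)
    (hL2 : (p * ((1 - r₂) * r₁) * (a + b₁) + (1 - p) * (r₂ * r₁) * (a + c) + (p * ((1 - r₂) * (1 - r₁)) + (1 - p) * (r₂ * (1 - r₁)) + (1 - p) * ((1 - r₂) * r₁) + (1 - p) * ((1 - r₂) * (1 - r₁))) * (a + c + b₁)) ≤ t) :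
    (p * ((1 - r₁) * (1 - r₂)) * (a + c) + (1 - p) * (r₁ * r₂) * (a + c) + (1 - p) * (r₁ * (1 - r₂)) * (a + c + b₂) + (1 - p) * ((1 - r₁) * r₂) * (a + c + b₁) + (1 - p) * ((1 - r₁) * (1 - r₂)) * (a + c + b₂ + b₁)) ≤ t := by
  have h1p : 0 ≤ 1 - p := by linarith
  have h1r1 : 0 ≤ 1 - r₁ := by linarith
  have h1r2 : 0 ≤ 1 - r₂ := by linarith
  -- the coupled case is file IV
  by_cases hΔ0 : ((1 - p) ^ 2 - (p + (1 - p) * r₁) * (p + (1 - p) * r₂)) ≤ 0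
  · exact arith_coupled p r₁ r₂ (a + c) (a + c + b₂) (a + c + b₁) (a + c + b₂ + b₁) (a + b₂) (a + b₁) t hp0 hp1 hr10 hr11 hr20 hr21
      (by linarith) (by linarith) (by linarith) (by linarith) (by linarith) hL1 hL2
  have hΔpos : 0 < ((1 - p) ^ 2 - (p + (1 - p) * r₁) * (p + (1 - p) * r₂)) := lt_of_not_ge hΔ0
  obtain ⟨hB, hD⟩ := hreg.resolve_left hΔ0
  have hs1n : 0 ≤ (p + (1 - p) * r₁) := by positivity
  have hs2n : 0 ≤ (p + (1 - p) * r₂) := by positivity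
  have hk1n : 0 ≤ ((p + (1 - p) * r₁) * r₂ + (1 - p) * r₁) := by positivity
  have hk2n : 0 ≤ ((p + (1 - p) * r₂) * r₁ + (1 - p) * r₂) := by positivity
  have hPn : 0 ≤ (p * ((p + (1 - p) * r₁) * r₂ + (1 - p) * r₁) * ((p + (1 - p) * r₂) * r₁ + (1 - p) * r₂)) := by positivity
  -- Harris in polynomial form
  have hd' : d = 1 - a - b₁ - b₂ - c := by linarith
  have hH1' : 0 ≤ a * d - b₁ * b₂ - b₁ * c := by
    have e : a * d - b₁ * b₂ - b₁ * c = a - (a + c + b₂) * (a + b₁) := by rw [hd']; ring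
    rw [e]; linarith
  have hH3' : 0 ≤ a * d - c * b₁ - c * b₂ := by
    have e : a * d - c * b₁ - c * b₂ = a - (a + b₁ + b₂) * (a + c) := by rw [hd']; ring
    rw [e]; linarith
  -- the cut at `v` with the unit mass written as the total mass
  have hLv' : ((1 - p) * (r₁ * r₂) * (a + c) + (1 - p) * (r₁ * (1 - r₂)) * (a + c + b₂) + (1 - p) * ((1 - r₁) * r₂) * (a + c + b₁) + (1 - p) * ((1 - r₁) * (1 - r₂)) * (a + b₁ + b₂ + c + d)) ≤ t := by
    rw [hsum, mul_one]; exact hLv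
  -- nonnegativity of the weights
  have hw1n : 0 ≤ (p * ((p + (1 - p) * r₂) * r₁ + (1 - p) * r₂) * (p + (1 - p) * r₁) * a + ((1 - p) ^ 2 - (p + (1 - p) * r₁) * (p + (1 - p) * r₂)) * (1 - p) * b₂ + p * ((p + (1 - p) * r₁) * r₂ + (1 - p) * r₁) * (1 - p) * c) := by
    have t2 : 0 ≤ ((1 - p) ^ 2 - (p + (1 - p) * r₁) * (p + (1 - p) * r₂)) * (1 - p) * b₂ := mul_nonneg (mul_nonneg hΔpos.le h1p) hb2
    have t1 : 0 ≤ p * ((p + (1 - p) * r₂) * r₁ + (1 - p) * r₂) * (p + (1 - p) * r₁) * a := by positivity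
    have t3 : 0 ≤ p * ((p + (1 - p) * r₁) * r₂ + (1 - p) * r₁) * (1 - p) * c := by positivity
    linarith
  have hw2n : 0 ≤ (p * ((p + (1 - p) * r₂) * r₁ + (1 - p) * r₂) * (1 - p) * a + ((1 - p) ^ 2 - (p + (1 - p) * r₁) * (p + (1 - p) * r₂)) * (p + (1 - p) * r₂) * b₂ + p * ((p + (1 - p) * r₁) * r₂ + (1 - p) * r₁) * (p + (1 - p) * r₂) * c) := by
    have t2 : 0 ≤ ((1 - p) ^ 2 - (p + (1 - p) * r₁) * (p + (1 - p) * r₂)) * (p + (1 - p) * r₂) * b₂ := mul_nonneg (mul_nonneg hΔpos.le hs2n) hb2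
    have t1 : 0 ≤ p * ((p + (1 - p) * r₂) * r₁ + (1 - p) * r₂) * (1 - p) * a := by positivity
    have t3 : 0 ≤ p * ((p + (1 - p) * r₁) * r₂ + (1 - p) * r₁) * (p + (1 - p) * r₂) * c := by positivity
    linarith
  -- the certificate: `S ≤ 0`
  have hS : (p * ((p + (1 - p) * r₁) * r₂ + (1 - p) * r₁) * ((p + (1 - p) * r₂) * r₁ + (1 - p) * r₂)) * a * ((p * ((1 - r₁) * (1 - r₂)) * (a + c) + (1 - p) * (r₁ * r₂) * (a + c) + (1 - p) * (r₁ * (1 - r₂)) * (a + c + b₂) + (1 - p) * ((1 - r₁) * r₂) * (a + c + b₁) + (1 - p) * ((1 - r₁) * (1 - r₂)) * (a + c + b₂ + b₁)) - ((1 - p) * (r₁ * r₂) * (a + c) + (1 - p) * (r₁ * (1 - r₂)) * (a + c + b₂) + (1 - p) * ((1 - r₁) * r₂) * (a + c + b₁) + (1 - p) * ((1 - r₁) * (1 - r₂)) * (a + b₁ + b₂ + c + d))) + (1 - r₂) * (p * ((p + (1 - p) * r₂) * r₁ + (1 - p) * r₂) * (p + (1 - p) * r₁) * a + ((1 - p)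 ^ 2 - (p + (1 - p) * r₁) * (p + (1 - p) * r₂)) * (1 - p) * b₂ + p * ((p + (1 - p) * r₁) * r₂ + (1 - p) * r₁) * (1 - p) * c) * ((p * ((1 - r₁) * (1 - r₂)) * (a + c) + (1 - p) * (r₁ * r₂) * (a + c) + (1 - p) * (r₁ * (1 - r₂)) * (a + c + b₂) + (1 - p) * ((1 - r₁) * r₂) * (a + c + b₁) + (1 - p) * ((1 - r₁) * (1 - r₂)) * (a + c + b₂ + b₁)) - (p * ((1 - r₁) * r₂) * (a + b₂) + (1 - p) * (r₁ * r₂) * (a + c) + (p * ((1 - r₁) * (1 - r₂)) + (1 - p) * (r₁ * (1 - r₂)) + (1 - p) * ((1 - r₁) * r₂) + (1 - p) * ((1 - r₁) * (1 - r₂))) * (a + c + b₂))) + (1 - r₁) * (p * ((p + (1 - p) * r₂) * r₁ + (1 - p) * r₂) * (1 - p) * a + ((1 - p) ^ 2 - (p + (1 - p) * r₁) * (p + (1 - p) * r₂)) * (p + (1 - p) * r₂) * b₂ + p * ((p + (1 - p) * r₁) * r₂ + (1 - p) * r₁) * (p + (1 - p) * r₂) * c) * ((p * ((1 - r₁) *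 (1 - r₂)) * (a + c) + (1 - p) * (r₁ * r₂) * (a + c) + (1 - p) * (r₁ * (1 - r₂)) * (a + c + b₂) + (1 - p) * ((1 - r₁) * r₂) * (a + c + b₁) + (1 - p) * ((1 - r₁) * (1 - r₂)) * (a + c + b₂ + b₁)) - (p * ((1 - r₂) * r₁) * (a + b₁) + (1 - p) * (r₂ * r₁) * (a + c) + (p * ((1 - r₂) * (1 - r₁)) + (1 - p) * (r₂ * (1 - r₁)) + (1 - p) * ((1 - r₂) * r₁) + (1 - p) * ((1 - r₂) * (1 - r₁))) * (a + c + b₁))) ≤ 0 := by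
    have i4 : 0 ≤ (1 - r₁) * (1 - r₂) := mul_nonneg h1r1 h1r2
    by_cases hcase : p * ((p + (1 - p) * r₁) * r₂ + (1 - p) * r₁) ≤ ((1 - p) ^ 2 - (p + (1 - p) * r₁) * (p + (1 - p) * r₂))
    · rw [tame_identity_A]
      have i1 : 0 ≤ ((1 - p) ^ 2 - (p + (1 - p) * r₁) * (p + (1 - p) * r₂)) ^ 2 * (a * d - b₁ * b₂ - b₁ * c) := mul_nonneg (sq_nonneg _) hH1'
      have i2 : 0 ≤ ((p * ((p + (1 - p) * r₁) * r₂ + (1 - p) * r₁) * ((p + (1 - p) * r₂) * r₁ + (1 - p) * r₂)) * (1 - p) - ((1 - p) ^ 2 - (p + (1 - p) * r₁) * (p + (1 - p) * r₂)) ^ 2) * (a * d) := by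
        refine mul_nonneg ?_ (mul_nonneg ha hd)
        have : (p * ((p + (1 - p) * r₁) * r₂ + (1 - p) * r₁) * ((p + (1 - p) * r₂) * r₁ + (1 - p) * r₂)) * (1 - p) = p * (1 - p) * ((p + (1 - p) * r₁) * r₂ + (1 - p) * r₁) * ((p + (1 - p) * r₂) * r₁ + (1 - p) * r₂) := by ring
        rw [this]; linarith
      have i3 : 0 ≤ ((1 - p) ^ 2 - (p + (1 - p) * r₁) * (p + (1 - p) * r₂)) * (((1 - p) ^ 2 - (p + (1 - p) * r₁) * (p + (1 - p) * r₂)) - p * ((p + (1 - p) * r₁) * r₂ + (1 - p) * r₁)) * (b₁ * c) :=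
        mul_nonneg (mul_nonneg hΔpos.le (by linarith)) (mul_nonneg hb1 hc)
      have hin := mul_nonneg i4 (show 0 ≤ ((1 - p) ^ 2 - (p + (1 - p) * r₁) * (p + (1 - p) * r₂)) ^ 2 * (a * d - b₁ * b₂ - b₁ * c) + ((p * ((p + (1 - p) * r₁) * r₂ + (1 - p) * r₁) * ((p + (1 - p) * r₂) * r₁ + (1 - p) * r₂)) * (1 - p) - ((1 - p) ^ 2 - (p + (1 - p) * r₁) * (p + (1 - p) * r₂)) ^ 2) * (a * d) +
        ((1 - p) ^ 2 - (p + (1 - p) * r₁) * (p + (1 - p) * r₂)) * (((1 - p) ^ 2 - (p + (1 - p) * r₁) * (p + (1 - p) * r₂)) - p * ((p + (1 - p) * r₁) * r₂ + (1 - p) * r₁)) * (b₁ * c) by linarith)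
      linarith
    · have hcase' : ((1 - p) ^ 2 - (p + (1 - p) * r₁) * (p + (1 - p) * r₂)) ≤ p * ((p + (1 - p) * r₁) * r₂ + (1 - p) * r₁) := le_of_not_ge hcase
      rw [tame_identity_B]
      have i1 : 0 ≤ ((1 - p) ^ 2 - (p + (1 - p) * r₁) * (p + (1 - p) * r₂)) ^ 2 * (a * d - b₁ * b₂ - b₁ * c) := mul_nonneg (sq_nonneg _) hH1'
      have i2 : 0 ≤ ((1 - p) ^ 2 - (p + (1 - p) * r₁) * (p + (1 - p) * r₂)) * (p * ((p + (1 - p) * r₁) * r₂ + (1 - p) * r₁) - ((1 - p) ^ 2 - (p + (1 - p) * r₁) * (p + (1 - p) * r₂))) * (a * d - c * b₁ - c * b₂) :=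
        mul_nonneg (mul_nonneg hΔpos.le (by linarith)) hH3'
      have i3 : 0 ≤ ((p * ((p + (1 - p) * r₁) * r₂ + (1 - p) * r₁) * ((p + (1 - p) * r₂) * r₁ + (1 - p) * r₂)) * (1 - p) - ((1 - p) ^ 2 - (p + (1 - p) * r₁) * (p + (1 - p) * r₂)) * (p * ((p + (1 - p) * r₁) * r₂ + (1 - p) * r₁))) * (a * d) := by
        refine mul_nonneg ?_ (mul_nonneg ha hd)
        have e : (p * ((p + (1 - p) * r₁) * r₂ + (1 - p) * r₁) * ((p + (1 - p) * r₂) * r₁ + (1 - p) * r₂)) * (1 - p) - ((1 - p) ^ 2 - (p + (1 - p) * r₁) * (p + (1 - p) * r₂)) * (p * ((p + (1 - p) * r₁) * r₂ + (1 - p) * r₁)) = p * ((p + (1 - p) * r₁) * r₂ + (1 - p) * r₁) * ((1 - p) * ((p + (1 - p) * r₂) * r₁ + (1 - p) * r₂) - ((1 - p) ^ 2 - (p + (1 - p) * r₁) * (p + (1 - p) * r₂))) := by ring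
        rw [e]
        exact mul_nonneg (mul_nonneg hp0 hk1n) (by linarith)
      have i5 : 0 ≤ ((1 - p) ^ 2 - (p + (1 - p) * r₁) * (p + (1 - p) * r₂)) * (p * ((p + (1 - p) * r₁) * r₂ + (1 - p) * r₁) - ((1 - p) ^ 2 - (p + (1 - p) * r₁) * (p + (1 - p) * r₂))) * (b₂ * c) :=
        mul_nonneg (mul_nonneg hΔpos.le (by linarith)) (mul_nonneg hb2 hc)
      have hin := mul_nonneg i4 (show 0 ≤ ((1 - p) ^ 2 - (p + (1 - p) * r₁) * (p + (1 - p) * r₂)) ^ 2 * (a * d - b₁ * b₂ - b₁ * c) + ((1 - p) ^ 2 - (p + (1 - p) * r₁) * (p + (1 - p) * r₂)) * (p * ((p + (1 - p) * r₁) * r₂ + (1 - p) * r₁) - ((1 - p) ^ 2 - (p + (1 - p) * r₁) * (p + (1 - p) * r₂))) * (a * d - c * b₁ - c * b₂) +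
        ((p * ((p + (1 - p) * r₁) * r₂ + (1 - p) * r₁) * ((p + (1 - p) * r₂) * r₁ + (1 - p) * r₂)) * (1 - p) - ((1 - p) ^ 2 - (p + (1 - p) * r₁) * (p + (1 - p) * r₂)) * (p * ((p + (1 - p) * r₁) * r₂ + (1 - p) * r₁))) * (a * d) + ((1 - p) ^ 2 - (p + (1 - p) * r₁) * (p + (1 - p) * r₂)) * (p * ((p + (1 - p) * r₁) * r₂ + (1 - p) * r₁) - ((1 - p) ^ 2 - (p + (1 - p) * r₁) * (p + (1 - p) * r₂))) * (b₂ * c) by linarith)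
      linarith
  -- abstract the pieces
  have hev := tame_excess_v p r₁ r₂ a b₁ b₂ c d
  have he2 := tame_excess_2 p r₁ r₂ a b₁ b₂ c
  generalize hUdef : (p * ((1 - r₁) * (1 - r₂)) * (a + c) + (1 - p) * (r₁ * r₂) * (a + c) + (1 - p) * (r₁ * (1 - r₂)) * (a + c + b₂) + (1 - p) * ((1 - r₁) * r₂) * (a + c + b₁) + (1 - p) * ((1 - r₁) * (1 - r₂)) * (a + c + b₂ + b₁)) = U at hS hev he2 ⊢
  generalize hLvdef : ((1 - p) * (r₁ * r₂) * (a + c) + (1 - p) * (r₁ * (1 - r₂)) * (a + c + b₂) + (1 - p) * ((1 - r₁) * r₂) * (a + c + b₁) + (1 - p) * ((1 - r₁) * (1 - r₂)) * (a + b₁ + b₂ + c + d)) = Lv at hS hev hLv'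
  generalize hL1def : (p * ((1 - r₁) * r₂) * (a + b₂) + (1 - p) * (r₁ * r₂) * (a + c) + (p * ((1 - r₁) * (1 - r₂)) + (1 - p) * (r₁ * (1 - r₂)) + (1 - p) * ((1 - r₁) * r₂) + (1 - p) * ((1 - r₁) * (1 - r₂))) * (a + c + b₂)) = L1 at hS hL1
  generalize hL2def : (p * ((1 - r₂) * r₁) * (a + b₁) + (1 - p) * (r₂ * r₁) * (a + c) + (p * ((1 - r₂) * (1 - r₁)) + (1 - p) * (r₂ * (1 - r₁)) + (1 - p) * ((1 - r₂) * r₁) + (1 - p) * ((1 - r₂) * (1 - r₁))) * (a + c + b₁)) = L2 at hS he2 hL2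
  generalize hw1def : (p * ((p + (1 - p) * r₂) * r₁ + (1 - p) * r₂) * (p + (1 - p) * r₁) * a + ((1 - p) ^ 2 - (p + (1 - p) * r₁) * (p + (1 - p) * r₂)) * (1 - p) * b₂ + p * ((p + (1 - p) * r₁) * r₂ + (1 - p) * r₁) * (1 - p) * c) = w1 at hS hw1n
  generalize hw2def : (p * ((p + (1 - p) * r₂) * r₁ + (1 - p) * r₂) * (1 - p) * a + ((1 - p) ^ 2 - (p + (1 - p) * r₁) * (p + (1 - p) * r₂)) * (p + (1 - p) * r₂) * b₂ + p * ((p + (1 - p) * r₁) * r₂ + (1 - p) * r₁) * (p + (1 - p) * r₂) * c) = w2 at hS hw2n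
  generalize hPdef : (p * ((p + (1 - p) * r₁) * r₂ + (1 - p) * r₁) * ((p + (1 - p) * r₂) * r₁ + (1 - p) * r₂)) = P at hS hPn
  -- weights
  have hWv : 0 ≤ P * a := mul_nonneg hPn ha
  have hW1 : 0 ≤ (1 - r₂) * w1 := mul_nonneg h1r2 hw1n
  have hW2 : 0 ≤ (1 - r₁) * w2 := mul_nonneg h1r1 hw2n
  by_cases hW : 0 < P * a + (1 - r₂) * w1 + (1 - r₁) * w2
  · have a0 := mul_le_mul_of_nonneg_left hLv' hWv
    have a1 := mul_le_mul_of_nonneg_left hL1 hW1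
    have a2 := mul_le_mul_of_nonneg_left hL2 hW2
    have h1 : (P * a + (1 - r₂) * w1 + (1 - r₁) * w2) * U ≤ (P * a + (1 - r₂) * w1 + (1 - r₁) * w2) * t := by
      have e1 : (P * a + (1 - r₂) * w1 + (1 - r₁) * w2) * U =
          (P * a * (U - Lv) + (1 - r₂) * w1 * (U - L1) + (1 - r₁) * w2 * (U - L2)) +
            (P * a * Lv + (1 - r₂) * w1 * L1 + (1 - r₁) * w2 * L2) := by ring
      have e2 : (P * a + (1 - r₂) * w1 + (1 - r₁) * w2) * t = P * a * t + (1 - r₂) * w1 * t + (1 - r₁) * w2 * t := by ring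
      rw [e1, e2]; linarith
    exact le_of_mul_le_mul_left h1 hW
  · -- degenerate weights
    have hW0 : (1 - r₁) * w2 = 0 := by linarith
    rcases mul_eq_zero.1 hW0 with hr1 | hw20
    · have : U - Lv = 0 := by rw [hev, hr1]; ring
      linarith
    · have t1 : 0 ≤ p * ((p + (1 - p) * r₂) * r₁ + (1 - p) * r₂) * (1 - p) * a := by positivity
      have t3 : 0 ≤ p * ((p + (1 - p) * r₁) * r₂ + (1 - p) * r₁) * (p + (1 - p) * r₂) * c := by positivity
      have t2n : 0 ≤ ((1 - p) ^ 2 - (p + (1 - p) * r₁) * (p + (1 - p) * r₂)) * (p + (1 - p) * r₂) * b₂ := mul_nonneg (mul_nonneg hΔpos.le hs2n) hb2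
      have t2 : ((1 - p) ^ 2 - (p + (1 - p) * r₁) * (p + (1 - p) * r₂)) * (p + (1 - p) * r₂) * b₂ = 0 := by
        rw [← hw2def] at hw20
        linarith
      rcases mul_eq_zero.1 t2 with h' | hb20
      · rcases mul_eq_zero.1 h' with hΔz | hs20
        · exact absurd hΔz hΔpos.ne'
        · have hp00 : p = 0 := by
            have : 0 ≤ (1 - p) * r₂ := mul_nonneg h1p hr20
            linarith
          have : U - Lv ≤ 0 := by
            rw [hev, hp00]
            have e : (1 - r₁) * (1 - r₂) * (0 * (a + c) - (1 - 0) * d) = -((1 - r₁) * (1 - r₂) * d) := by ring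
            rw [e, neg_nonpos]
            exact mul_nonneg (mul_nonneg h1r1 h1r2) hd
          linarith
      · have : U - L2 ≤ 0 := by
          rw [he2, hb20]
          have i1 : 0 ≤ (p + (1 - p) * r₁) * b₁ := mul_nonneg hs1n hb1
          have i2 : 0 ≤ p * r₁ * a := by positivity
          have e : (1 - r₂) * ((1 - p) * 0 - (p + (1 - p) * r₁) * b₁ - p * r₁ * a) = -((1 - r₂) * ((p + (1 - p) * r₁) * b₁ + p * r₁ * a)) := by ring
          rw [e, neg_nonpos]
          exact mul_nonneg h1r2 (by linarith)
        linarith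

end Gate3

/-- **FAR at layer one for a TAME degree-three gate at the observer** (coupled, or in the Harris regime `Δ² ≤ p(1−p)κ₁κ₂`, `Δ ≤ (1−p)κ₂`):
the three cuts at `v, u₁, u₂` bound `P(#{a ∈ A : o ↔ a} ≤ 1)`; no mean hypothesis. [this work] -/
theorem farLayerOne_of_gate3_tame (w : Sym2 (Fin n) → unitInterval) (A : Finset (Fin n)) {o v u₁ u₂ : Fin n}
    (hov : o ≠ v) (h1v : u₁ ≠ v) (h2v : u₂ ≠ v) (ho1 : o ≠ u₁) (ho2 : o ≠ u₂) (h12 : u₁ ≠ u₂)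
    (hvA : v ∈ A) (h1A : u₁ ∈ A) (h2A : u₂ ∈ A)
    (hw : ∀ z : Fin n, z ≠ o → z ≠ u₁ → z ≠ u₂ → z ≠ v → (w s(v, z) : ℝ) = 0)
    (htame : ((1 - (w s(o, v) : ℝ)) ^ 2 - ((w s(o, v) : ℝ) + (1 - (w s(o, v) : ℝ)) * (w s(v, u₁) : ℝ)) * ((w s(o, v) : ℝ) + (1 - (w s(o, v) : ℝ)) * (w s(v, u₂) : ℝ))) ≤ 0 ∨
      (((1 - (w s(o, v) : ℝ)) ^ 2 - ((w s(o, v) : ℝ) + (1 - (w s(o, v) : ℝ)) * (w s(v, u₁) : ℝ)) * ((w s(o, v) : ℝ) + (1 - (w s(o, v) : ℝ)) * (w s(v, u₂) : ℝ))) ^ 2 ≤ (w s(o, v) : ℝ) * (1 - (w s(o, v) : ℝ)) * (((w s(o, v) : ℝ) + (1 - (w s(o, v) : ℝ)) * (w s(v, u₁) : ℝ)) * (w s(v, u₂) : ℝ) + (1 - (w s(o, v) : ℝ)) * (w s(v, u₁) : ℝ)) * (((w s(o, v) : ℝ) + (1 - (w s(o, v) : ℝ)) * (w s(v, u₂) :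 ℝ)) * (w s(v, u₁) : ℝ) + (1 - (w s(o, v) : ℝ)) * (w s(v, u₂) : ℝ)) ∧ ((1 - (w s(o, v) : ℝ)) ^ 2 - ((w s(o, v) : ℝ) + (1 - (w s(o, v) : ℝ)) * (w s(v, u₁) : ℝ)) * ((w s(o, v) : ℝ) + (1 - (w s(o, v) : ℝ)) * (w s(v, u₂) : ℝ))) ≤ (1 - (w s(o, v) : ℝ)) * (((w s(o, v) : ℝ) + (1 - (w s(o, v) : ℝ)) * (w s(v, u₂) : ℝ)) * (w s(v, u₁) : ℝ) + (1 - (w s(o, v) : ℝ)) * (w s(v, u₂) : ℝ))))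
    (t : ℝ) (hcutv : (prodBernoulli w).real (openConn o v : Set (BondConfig (Fin n)))ᶜ ≤ t)
    (hcut₁ : (prodBernoulli w).real (openConn o u₁ : Set (BondConfig (Fin n)))ᶜ ≤ t)
    (hcut₂ : (prodBernoulli w).real (openConn o u₂ : Set (BondConfig (Fin n)))ᶜ ≤ t) :
    (prodBernoulli w).real {ω : BondConfig (Fin n) | (A.filter fun a => ω ∈ openConn o a).card ≤ 1} ≤ t := by
  set μ := prodBernoulli w with hμ
  have hp0 : 0 ≤ (w s(o, v) : ℝ) := (w s(o, v)).2.1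
  have hp1 : (w s(o, v) : ℝ) ≤ 1 := (w s(o, v)).2.2
  have hr10 : 0 ≤ (w s(v, u₁) : ℝ) := (w s(v, u₁)).2.1
  have hr11 : (w s(v, u₁) : ℝ) ≤ 1 := (w s(v, u₁)).2.2
  have hr20 : 0 ≤ (w s(v, u₂) : ℝ) := (w s(v, u₂)).2.1
  have hr21 : (w s(v, u₂) : ℝ) ≤ 1 := (w s(v, u₂)).2.2
  -- the laws (files III, V)
  have hN := Gate3.real_card_le_one_le w hw hov h1v h2v ho1 ho2 h12 A hvA h1A h2A
  have hLv := Gate3.real_compl_openConn_v_eq (v := v) w hw hov h1v h2v ho1 ho2 h12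
  have hL1 := Gate3.real_compl_openConn_u₁_eq (v := v) w hw hov h1v h2v ho1 ho2 h12
  have hL2 := Gate3.real_compl_openConn_u₂_eq (v := v) w hw hov h1v h2v ho1 ho2 h12
  rw [← hμ] at hN hLv hL1 hL2
  -- the type masses
  have hx := Gate3.real_nG₁nG₂_eq (o := o) (v := v) (u₁ := u₁) (u₂ := u₂) μ
  have hy1 := Gate3.real_nG₁_eq (o := o) (v := v) (u₁ := u₁) (u₂ := u₂) μ
  have hy2 := Gate3.real_nG₂_eq (o := o) (v := v) (u₁ := u₁) (u₂ := u₂) μ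
  have hz := Gate3.real_nG₁G₂_eq (o := o) (v := v) (u₁ := u₁) (u₂ := u₂) μ
  have hh1 := Gate3.real_nG₁nH_eq (o := o) (v := v) (u₁ := u₁) (u₂ := u₂) μ
  have hh2 := Gate3.real_nG₂nH_eq (o := o) (v := v) (u₁ := u₁) (u₂ := u₂) μ
  have hnh := Gate3.real_nH_eq (o := o) (v := v) (u₁ := u₁) (u₂ := u₂) μ
  have hsum := Gate3.real_types_sum (o := o) (v := v) (u₁ := u₁) (u₂ := u₂) μ
  rw [probReal_univ] at hsum
  have hH1 := Gate3.real_harris₁ (o := o) (v := v) (u₁ := u₁) (u₂ := u₂) w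
  have hH3 := Gate3.real_harris₃ (o := o) (v := v) (u₁ := u₁) (u₂ := u₂) w
  rw [← hμ] at hH1 hH3
  -- abstract the event probabilities
  generalize ha : μ.real {ω : BondConfig (Fin n) | ¬ (openGraph (offZ {v} ω)).Reachable o u₁ ∧ ¬ (openGraph (offZ {v} ω)).Reachable o u₂ ∧
      ¬ (openGraph (offZ {v} ω)).Reachable u₁ u₂} = a at hx hh1 hh2 hnh hsum hH1 hH3
  generalize hb1 : μ.real {ω : BondConfig (Fin n) | (openGraph (offZ {v} ω)).Reachable o u₁ ∧ ¬ (openGraph (offZ {v} ω)).Reachable o u₂} = b₁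
    at hy2 hz hh2 hnh hsum
  generalize hb2 : μ.real {ω : BondConfig (Fin n) | (openGraph (offZ {v} ω)).Reachable o u₂ ∧ ¬ (openGraph (offZ {v} ω)).Reachable o u₁} = b₂
    at hy1 hh1 hnh hsum
  generalize hc : μ.real {ω : BondConfig (Fin n) | ¬ (openGraph (offZ {v} ω)).Reachable o u₁ ∧ ¬ (openGraph (offZ {v} ω)).Reachable o u₂ ∧
      (openGraph (offZ {v} ω)).Reachable u₁ u₂} = c at hx hsum
  generalize hd : μ.real {ω : BondConfig (Fin n) | (openGraph (offZ {v} ω)).Reachable o u₁ ∧ (openGraph (offZ {v} ω)).Reachable o u₂} = d at hsum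
  generalize hxx : μ.real {ω : BondConfig (Fin n) | ¬ (openGraph (offZ {v} ω)).Reachable o u₁ ∧ ¬ (openGraph (offZ {v} ω)).Reachable o u₂} = x
    at hx hy1 hy2 hN hLv hL1 hL2 hH3
  generalize hyy1 : μ.real {ω : BondConfig (Fin n) | ¬ (openGraph (offZ {v} ω)).Reachable o u₁} = y₁ at hy1 hz hN hLv hL1 hH1
  generalize hyy2 : μ.real {ω : BondConfig (Fin n) | ¬ (openGraph (offZ {v} ω)).Reachable o u₂} = y₂ at hy2 hN hLv hL2
  generalize hzz : μ.real {ω : BondConfig (Fin n) | ¬ ((openGraph (offZ {v} ω)).Reachable o u₁ ∧ (openGraph (offZ {v} ω)).Reachable o u₂)} = z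
    at hz hN
  generalize hhh1 : μ.real {ω : BondConfig (Fin n) | ¬ (openGraph (offZ {v} ω)).Reachable o u₁ ∧ ¬ (openGraph (offZ {v} ω)).Reachable u₂ u₁} = h₁
    at hh1 hL1
  generalize hhh2 : μ.real {ω : BondConfig (Fin n) | ¬ (openGraph (offZ {v} ω)).Reachable o u₂ ∧ ¬ (openGraph (offZ {v} ω)).Reachable u₁ u₂} = h₂
    at hh2 hL2 hH1
  generalize hnn : μ.real {ω : BondConfig (Fin n) | ¬ (openGraph (offZ {v} ω)).Reachable u₁ u₂} = nh at hnh hH3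
  have ha0 : 0 ≤ a := by rw [← ha]; exact measureReal_nonneg
  have hb10 : 0 ≤ b₁ := by rw [← hb1]; exact measureReal_nonneg
  have hb20 : 0 ≤ b₂ := by rw [← hb2]; exact measureReal_nonneg
  have hc0 : 0 ≤ c := by rw [← hc]; exact measureReal_nonneg
  have hd0 : 0 ≤ d := by rw [← hd]; exact measureReal_nonneg
  subst hx hy1 hy2 hz hh1 hh2 hnh
  rw [hLv] at hcutv
  rw [hL1] at hcut₁
  rw [hL2] at hcut₂
  have key := Gate3.arith_tame (w s(o, v) : ℝ) (w s(v, u₁)) (w s(v, u₂)) a b₁ b₂ c d t hp0 hp1 hr10 hr11 hr20 hr21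
    ha0 hb10 hb20 hc0 hd0 hsum htame (by linarith [hH1]) (by linarith [hH3])
    (by linarith [hcutv]) (by linarith [hcut₁]) (by linarith [hcut₂])
  linarith [hN, key]

/-- The same with the cut hypothesis of `Quant.FarRelayRow` (all relays). [this work] -/
theorem farLayerOne_of_gate3_tame' (w : Sym2 (Fin n) → unitInterval) (A : Finset (Fin n)) {o v u₁ u₂ : Fin n}
    (hov : o ≠ v) (h1v : u₁ ≠ v) (h2v : u₂ ≠ v) (ho1 : o ≠ u₁) (ho2 : o ≠ u₂) (h12 : u₁ ≠ u₂)
    (hvA : v ∈ A) (h1A : u₁ ∈ A) (h2A : u₂ ∈ A)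
    (hw : ∀ z : Fin n, z ≠ o → z ≠ u₁ → z ≠ u₂ → z ≠ v → (w s(v, z) : ℝ) = 0)
    (htame : ((1 - (w s(o, v) : ℝ)) ^ 2 - ((w s(o, v) : ℝ) + (1 - (w s(o, v) : ℝ)) * (w s(v, u₁) : ℝ)) * ((w s(o, v) : ℝ) + (1 - (w s(o, v) : ℝ)) * (w s(v, u₂) : ℝ))) ≤ 0 ∨
      (((1 - (w s(o, v) : ℝ)) ^ 2 - ((w s(o, v) : ℝ) + (1 - (w s(o, v) : ℝ)) * (w s(v, u₁) : ℝ)) * ((w s(o, v) : ℝ) + (1 - (w s(o, v) : ℝ)) * (w s(v, u₂) : ℝ))) ^ 2 ≤ (w s(o, v) : ℝ) * (1 - (w s(o, v) : ℝ)) * (((w s(o, v) : ℝ) + (1 - (w s(o, v) : ℝ)) * (w s(v, u₁) : ℝ)) * (w s(v, u₂) : ℝ) + (1 - (w s(o, v) : ℝ)) * (w s(v, u₁) : ℝ)) * (((w s(o, v) : ℝ) + (1 - (w s(o, v) : ℝ)) * (w s(v, u₂) : ℝ)) * (w s(v, u₁) : ℝ) + (1 - (w s(o, v) : ℝ)) *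 (w s(v, u₂) : ℝ)) ∧ ((1 - (w s(o, v) : ℝ)) ^ 2 - ((w s(o, v) : ℝ) + (1 - (w s(o, v) : ℝ)) * (w s(v, u₁) : ℝ)) * ((w s(o, v) : ℝ) + (1 - (w s(o, v) : ℝ)) * (w s(v, u₂) : ℝ))) ≤ (1 - (w s(o, v) : ℝ)) * (((w s(o, v) : ℝ) + (1 - (w s(o, v) : ℝ)) * (w s(v, u₂) : ℝ)) * (w s(v, u₁) : ℝ) + (1 - (w s(o, v) : ℝ)) * (w s(v, u₂) : ℝ))))
    (t : ℝ) (hcut : ∀ a ∈ A, (prodBernoulli w).real (openConn o a : Set (BondConfig (Fin n)))ᶜ ≤ t) :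
    (prodBernoulli w).real {ω : BondConfig (Fin n) | (A.filter fun a => ω ∈ openConn o a).card ≤ 1} ≤ t :=
  farLayerOne_of_gate3_tame w A hov h1v h2v ho1 ho2 h12 hvA h1A h2A hw htame t (hcut v hvA) (hcut u₁ h1A) (hcut u₂ h2A)

end Quant

end Summit.CriticalPhenomena.PercolationContinuityZ3.Theorems
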